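import Summits.ResolutionOfSingularities.ResolutionOfSingularities.Theorems.FrobeniusClosingSteerNoSingularCarrierRun
import Summits.ResolutionOfSingularities.ResolutionOfSingularities.Theorems.FrobeniusClosingSteerMaxGenDictionary
import Summits.ResolutionOfSingularities.ResolutionOfSingularities.Theorems.FrobeniusClosingSteerHevLeafMax
import Summits.ResolutionOfSingularities.ResolutionOfSingularities.Theorems.FrobeniusClosingSteerWords11HighHalf
import Summits.ResolutionOfSingularities.ResolutionOfSingularities.Theorems.FrobeniusClosingSteerWords07SteeredLeaves
import Summits.ResolutionOfSingularities.ResolutionOfSingularities.Theorems.FrobeniusClosingSteerWords25ATailOddCore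
import Summits.ResolutionOfSingularities.ResolutionOfSingularities.Theorems.FrobeniusClosingSteerLocalGlobalFrobenius
import Summits.ResolutionOfSingularities.ResolutionOfSingularities.Theorems.FrobeniusClosingSteerMembersPerfectResidue
import Literature.AlgebraicGeometry.Hironaka2017.Lib.FFiniteOfFiniteType
import Literature.AlgebraicGeometry.Hironaka2017.Lib.FrobeniusPBasisEssFiniteType
import HarnessLib

/-!
res-L0-w41-strat-1 g10 — **MAX-NOTE-1** sketch (file-ready, def-free, Theses-free, 0 sorries): the (SH) branch of the even leaf is EMPTY.
OURS (campaign `res-hironaka`, rung L, slot W4.1, crux `Steer` stmt-ResolutionOfSingularities-16345; candidates' vocabulary made kernel;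
nothing here is a statement of the manuscript under review [claim: Hironaka2017, status: under-review]; AI work weaker than expert review).

# (SH)ᴵ holds outright: every POINT-STEP member of a σ_top-steered run from a `NormalAt` core datum is a MAXIMAL generator (p = 2)

Chain (every input LANDED): `NormalAt O (R 0) 2 t` ⟹ (N4) `NoSingularCarrier.noSingularCarrier_along_run` ⟹ `NoSingularCarrier` at every
stage ⟹ carrier dichotomy `NoSingularCarrier.normalAt_or_divisorCentre_of_noSingularCarrier`: at a POINT step the divisor disjunct
(`P i ≠ 𝔪`) is absurd ⟹ `NormalAt O (R i) 2 (s i)` ⟹ (M1 dictionary `MaxGenDictionary.not_isMaxGenAt_iff_nonunit_form` +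
`sq_eq_of_form`) `IsMaxGenAt (R i) 2 t (s i)`: a non-unit form `s i = a + b·s″` would square to the positive-value carrier `a² + b²·s″²`.
The (N4) side hypotheses are discharged from the leaf binders: `hreg` = `steeredMembersRegular_holds`, `hdim`/`hirr` = `runHygieneTwo_holds`,
`hRO`/`hloc` = `locAtCentre_le` / `locAtCentre_locAtCentre`, and `hN5` = §3 `memberFrobeniusCongruence_two` (re-base at the member
`steeredRebase_member_of_eternal` ⇒ ess. finite type over the perfect `k` ⇒ F-finite `isFFinite_of_essFiniteType'`; residue field perfect
`MembersPerfectResidue.perfectField_residueField_member`; then (N5) `LocalGlobalFrobenius.exists_global_of_local_frobenius_congruence_dvd`).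

Consequences: `shadowConclInd_holds : HevLeaf.StrippingTailSwitchingEvenInfShadowConclIndTwoN` (the (SH)ᴵ word of record, `…HevLeafMax`
p552660) is a THEOREM — its (SH) binder «∀ i₀, ∃ i ≥ i₀, IsPointStep R P i ∧ ¬ IsMaxGenAt (R i) p t (s i)» contradicts the word's own
`NormalAt` + `IsSteeredRun` binders; `evenInfConclInd_of_max : (MAX)ᴵ → [hEv-∞]ᴵ` (the landed re-cut with the (SH) half discharged);
`maxBinder_of_leafBinders`: the (MAX) binder holds with `i₀ = 0`. Hence (SH-NR)ᴵ / (SH-R)ᴵ (RULING 241(a)), (S♯), S1 and every LEMMA-M /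
slack / reach service for the (SH) branch are MOOT for the leaf: there is no legal (SH) member, eternal or not, on a run from a normalised start.
[cite: Kunz1969, Thm. 2.1] [cite: Matsumura1987, Thm. 20.3] [cite: NovacoskiSpivakovsky2014, Def. 2.11] [folklore]
-/

set_option linter.dupNamespace false
set_option autoImplicit false

namespace Summit.ResolutionOfSingularities.ResolutionOfSingularities.Theorems.SwitchingDichotomy.MaxVacuity

open IsLocalRing
open Literature.AlgebraicGeometry.Resolution
open Summit.ResolutionOfSingularities.ResolutionOfSingularities.Theorems.SwitchingDichotomy.Words
open Summit.ResolutionOfSingularities.ResolutionOfSingularities.Theorems.SwitchingDichotomy.Hull (GenAt)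
open Summit.ResolutionOfSingularities.ResolutionOfSingularities.Theorems.SwitchingDichotomy.MaxGenDictionary
open Summit.ResolutionOfSingularities.ResolutionOfSingularities.Theorems.SwitchingDichotomy.NoSingularCarrier
open Summit.ResolutionOfSingularities.ResolutionOfSingularities.Theorems.SteerRankThinness (Concl HasProperCoarsening)
open Summit.ResolutionOfSingularities.ResolutionOfSingularities.Theorems.SwitchingDichotomy.HevLeaf

variable {K : Type} [Field K]

/-! ## §1  maximality from `NormalAt` (p = 2; three lines over the landed M1 dictionary) -/

/-- A generator `s` of the `α₂`-torsor over a local subring `S` dominated by `O` which is `NormalAt` (no square carrier of positive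
value) is a MAXIMAL generator: a non-unit form `s = a + b·s″` squares to the carrier `s² = a² + b²·s″²`. OURS. [folklore] -/
theorem isMaxGenAt_of_normalAt_two [CharP K 2] (O : ValuationSubring K) (S : Subring K) [IsLocalRing S]
    (hval : ∀ a : S, a ∈ maximalIdeal S → O.valuation (a : K) < 1)
    {t s : K} (hs : GenAt S 2 t s) (hN : NormalAt O S 2 s) : IsMaxGenAt S 2 t s := by
  by_contra h
  obtain ⟨a, b, s'', h2, -, hb, hform⟩ := (not_isMaxGenAt_iff_nonunit_form S hs).mp h
  exact hN a b (s'' ^ 2) a.2 b.2 h2 (hval b hb) (sq_eq_of_form hform)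

/-! ## §2  `NormalAt` at every point-step stage (the (N4) engine + the carrier dichotomy, both landed) -/

/-- Along a steered run from a `NormalAt` start (hypotheses = those of (N4) `noSingularCarrier_along_run`), every POINT-STEP member is
`NormalAt`: the carrier dichotomy's divisor disjunct says `P i ≠ 𝔪`. OURS. [folklore] -/
theorem normalAt_of_pointStep_along_run (p : ℕ) [Fact p.Prime] [CharP K p] (O : ValuationSubring K)
    (R : ℕ → Subring K) (P : (i : ℕ) → Ideal (R i)) (t : K) (s : ℕ → K) {n : ℕ} (hn : 2 ≤ n)
    (hreg : ∀ i, IsRegularLocalRing (R i)) (hdim : ∀ i, ringKrullDim (R i) = n)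
    (hRO : R 0 ≤ O.toSubring) (hloc : locAtCentre (R 0) O = R 0)
    (hirr : ∀ i, ∀ y z : R i, (z : K) ≠ 0 → s i * z ≠ y)
    (hN5 : ∀ i, ∀ hs : s i ^ p ∈ R i, ∀ π a b c : R i, Prime π → ¬ π ∣ b →
      b ^ p * ⟨s i ^ p, hs⟩ = a ^ p + π ^ p * c → ∃ g₀ u₀ : R i, (⟨s i ^ p, hs⟩ : R i) = g₀ ^ p + π ^ p * u₀)
    (hN : NormalAt O (R 0) p t) (hrun : IsSteeredRun O R P t p s)
    (i : ℕ) (hPi : IsPointStep R P i) : NormalAt O (R i) p (s i) := by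
  classical
  have hNSC := noSingularCarrier_along_run p O R P t s hn hreg hdim hRO hloc hirr hN5 hN hrun
  obtain ⟨hs0, hstep⟩ := hrun
  have hmem := le_and_locAtCentre_eq_of_run R P hRO hloc fun i => by
    obtain ⟨_, _, _, hbl, _⟩ := hstep i
    exact hbl
  haveI := hreg i
  have hval : ∀ a : R i, a ∈ maximalIdeal (R i) ↔ O.valuation (a : K) < 1 :=
    mem_maximalIdeal_iff_of_locAtCentre_eq (hmem i).1 (hmem i).2
  obtain ⟨_, hs, hσ, hbl, hst⟩ := hstep i
  rcases normalAt_or_divisorCentre_of_noSingularCarrier p O (R i) (hdim i) hn hval hs (hirr i) (hNSC i)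
      (P i) hσ with hNi | ⟨hne, -⟩
  · exact hNi
  · obtain ⟨_, hPm⟩ := hPi
    exact absurd hPm hne

/-- `GenAt` propagates along a steered run: `t ∈ (R i)[s i]` for every `i` (`s i = x·s (i+1) + g`, `R i ≤ R (i+1)`). OURS. [folklore] -/
theorem genAt_along_run (p : ℕ) (O : ValuationSubring K) (R : ℕ → Subring K) (P : (i : ℕ) → Ideal (R i)) (t : K)
    (s : ℕ → K) (hrun : IsSteeredRun O R P t p s) (i : ℕ) : GenAt (R i) p t (s i) := by
  obtain ⟨hs0, hstep⟩ := hrun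
  induction i with
  | zero =>
    obtain ⟨_, hs, -⟩ := hstep 0
    exact ⟨hs, hs0 ▸ Subring.subset_closure (Set.mem_insert _ _)⟩
  | succ i ih =>
    obtain ⟨_, hs', -⟩ := hstep (i + 1)
    obtain ⟨_, hs, -, hbl, x, g, ⟨⟨hx, -⟩, -, -⟩, hg, hsx⟩ := hstep i
    refine ⟨hs', ?_⟩
    have hle : R i ≤ R (i + 1) := hbl.isLocalBlowup.le
    have hsi : s i ∈ Subring.closure (insert (s (i + 1)) (R (i + 1) : Set K)) := by
      rw [hsx]
      exact Subring.add_mem _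
        (Subring.mul_mem _ (Subring.subset_closure (Set.mem_insert_of_mem _ (hle hx)))
          (Subring.subset_closure (Set.mem_insert _ _)))
        (Subring.subset_closure (Set.mem_insert_of_mem _ (hle hg)))
    have hcl : Subring.closure (insert (s i) (R i : Set K)) ≤ Subring.closure (insert (s (i + 1)) (R (i + 1) : Set K)) :=
      Subring.closure_le.mpr (Set.insert_subset hsi
        (fun y hy => Subring.subset_closure (Set.mem_insert_of_mem _ (hle hy))))
    exact hcl ih.2

/-- **§2 headline (unfolded form).** Along a steered run from a `NormalAt` start, `p = 2`, every point-step member is a MAXIMAL generator.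
OURS. [folklore] -/
theorem isMaxGenAt_of_pointStep_along_run [Fact (Nat.Prime 2)] [CharP K 2] (O : ValuationSubring K)
    (R : ℕ → Subring K) (P : (i : ℕ) → Ideal (R i)) (t : K) (s : ℕ → K) {n : ℕ} (hn : 2 ≤ n)
    (hreg : ∀ i, IsRegularLocalRing (R i)) (hdim : ∀ i, ringKrullDim (R i) = n)
    (hRO : R 0 ≤ O.toSubring) (hloc : locAtCentre (R 0) O = R 0)
    (hirr : ∀ i, ∀ y z : R i, (z : K) ≠ 0 → s i * z ≠ y)
    (hN5 : ∀ i, ∀ hs : s i ^ 2 ∈ R i, ∀ π a b c : R i, Prime π → ¬ π ∣ b →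
      b ^ 2 * ⟨s i ^ 2, hs⟩ = a ^ 2 + π ^ 2 * c → ∃ g₀ u₀ : R i, (⟨s i ^ 2, hs⟩ : R i) = g₀ ^ 2 + π ^ 2 * u₀)
    (hN : NormalAt O (R 0) 2 t) (hrun : IsSteeredRun O R P t 2 s)
    (i : ℕ) (hPi : IsPointStep R P i) : IsMaxGenAt (R i) 2 t (s i) := by
  classical
  haveI := hreg i
  have hmem := le_and_locAtCentre_eq_of_run R P hRO hloc fun i => by
    obtain ⟨_, _, _, hbl, _⟩ := hrun.2 i
    exact hbl
  have hval : ∀ a : R i, a ∈ maximalIdeal (R i) ↔ O.valuation (a : K) < 1 :=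
    mem_maximalIdeal_iff_of_locAtCentre_eq (hmem i).1 (hmem i).2
  exact isMaxGenAt_of_normalAt_two O (R i) (fun a ha => (hval a).mp ha) (genAt_along_run 2 O R P t s hrun i)
    (normalAt_of_pointStep_along_run 2 O R P t s hn hreg hdim hRO hloc hirr hN5 hN hrun i hPi)

/-! ## §3  (N5) for every member of a steered run from a core datum (rebase at the member + Kunz; all inputs landed) -/

/-- **(N5) along steered runs, p = 2** — the local–global Frobenius congruence for every member `R i` of a steered run from a core datum
(= the `hN5` binder of (N4) `noSingularCarrier_along_run`). Re-base the datum at member `i` (`steeredRebase_member_of_eternal`: a finitely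
generated `A' ⊇ A₀` in `O` with `locAtCentre A' O = R i`) ⇒ `R i` is essentially of finite type over the perfect field `k` ⇒ F-finite
(`isFFinite_of_essFiniteType'`); its residue field is perfect (`perfectField_residueField_member`, `ZeroDim`); it is regular
(`steeredMembersRegular_holds`); then (N5) `LocalGlobalFrobenius.exists_global_of_local_frobenius_congruence_dvd`. OURS. [folklore]
[cite: Kunz1969, Thm. 2.1] -/
theorem memberFrobeniusCongruence_two
    (k K : Type) [Field k] [CharP k 2] [PerfectField k] [Field K] [Algebra k K]
    (O : ValuationSubring K) (A₀ : Subalgebra k K) (h₀ : A₀.toSubring ≤ O.toSubring) (t : K)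
    (core : CoreDatum 2 4 k K O A₀ h₀ t)
    (R : ℕ → Subring K) (P : (i : ℕ) → Ideal (R i)) (s : ℕ → K)
    (hR0 : R 0 = locAtCentre A₀.toSubring O) (hrun : IsSteeredRun O R P t 2 s)
    (i : ℕ) (hs : s i ^ 2 ∈ R i) (π a b c : R i) (hπ : Prime π) (hπb : ¬ π ∣ b)
    (heq : b ^ 2 * ⟨s i ^ 2, hs⟩ = a ^ 2 + π ^ 2 * c) :
    ∃ g₀ u₀ : R i, (⟨s i ^ 2, hs⟩ : R i) = g₀ ^ 2 + π ^ 2 * u₀ := by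
  classical
  haveI : Fact (Nat.Prime 2) := ⟨Nat.prime_two⟩
  haveI : CharP K 2 := charP_of_injective_algebraMap (algebraMap k K).injective 2
  have hzd : ZeroDim k O := by
    obtain ⟨-, -, -, -, -, hzd, -⟩ := core
    exact hzd
  -- the member is regular
  haveI hregi : IsRegularLocalRing (R i) :=
    steeredMembersRegular_holds 2 Nat.prime_two 4 le_rfl k K O A₀ h₀ t core R P s i hR0
      ⟨hrun.1, fun j _ => by obtain ⟨_, hs, -⟩ := hrun.2 j; exact hs, fun j _ => hrun.2 j⟩
  -- re-base at the member: `R i = locAtCentre A' O`, `A'` finitely generated over `k`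
  obtain ⟨A', h', hle, hRN, hfg', -⟩ :=
    steeredRebase_member_of_eternal 2 Nat.prime_two 4 k K O A₀ h₀ t core R P s hR0 hrun i
  have hRO : R i ≤ O.toSubring := hRN ▸ locAtCentre_le h'
  have hA : A₀.toSubring ≤ R i := fun x hx => hRN ▸ le_locAtCentre _ O (hle hx)
  -- perfect residue field
  haveI : PerfectField (ResidueField (R i)) :=
    MembersPerfectResidue.perfectField_residueField_member O A₀ R i hA hRO hzd
  -- F-finiteness through the finitely generated model
  have hF : Literature.AlgebraicGeometry.Resolution.IsFFinite 2 1 (R i) := by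
    letI algA : Algebra k A'.toSubring := A'.algebra
    haveI : Algebra.FiniteType k A'.toSubring := (Subalgebra.fg_iff_finiteType A').mp hfg'
    letI algS : Algebra k (locAtCentre A'.toSubring O) :=
      ((algebraMap A'.toSubring (locAtCentre A'.toSubring O)).comp (algebraMap k A'.toSubring)).toAlgebra
    haveI : IsScalarTower k A'.toSubring (locAtCentre A'.toSubring O) :=
      IsScalarTower.of_algebraMap_eq fun _ => rfl
    haveI := isLocalization_locAtCentre (B := A'.toSubring) (O := O) h'
    haveI : Algebra.EssFiniteType A'.toSubring (locAtCentre A'.toSubring O) :=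
      Algebra.EssFiniteType.of_isLocalization (locAtCentre A'.toSubring O)
        (subringCentre A'.toSubring O h').primeCompl
    haveI : Algebra.EssFiniteType k (locAtCentre A'.toSubring O) :=
      Algebra.EssFiniteType.comp k A'.toSubring (locAtCentre A'.toSubring O)
    haveI : ExpChar k 2 := ExpChar.prime Nat.prime_two
    haveI : PerfectRing k 2 := PerfectField.toPerfectRing 2
    have hF' : Literature.AlgebraicGeometry.Resolution.IsFFinite 2 1 (locAtCentre A'.toSubring O) :=
      Literature.AlgebraicGeometry.Hironaka2017.S02Preliminaries.isFFinite_of_essFiniteType' (𝕂 := k) 2 1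
    exact hRN ▸ hF'
  -- (N5)
  have hdiv : π ^ 2 ∣ b ^ 2 * ⟨s i ^ 2, hs⟩ - a ^ 2 := ⟨c, by rw [heq]; ring⟩
  obtain ⟨g, u, hu⟩ := LocalGlobalFrobenius.exists_global_of_local_frobenius_congruence_dvd hF hπ hπb hdiv
  exact ⟨g, u, by rw [← hu]; ring⟩

/-! ## §4  leaf level: every point-step member is maximal; (SH)ᴵ HOLDS OUTRIGHT; [hEv-∞]ᴵ ⟸ (MAX)ᴵ alone -/

/-- **Every point-step member of a steered run from a `NormalAt` core datum is a maximal generator** — leaf-binder form, no open input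
(binders = the first five run binders of every [hEv-∞]-family leaf word). OURS. [folklore] -/
theorem isMaxGenAt_of_isPointStep
    (k K : Type) [Field k] [CharP k 2] [PerfectField k] [Field K] [Algebra k K]
    (O : ValuationSubring K) (A₀ : Subalgebra k K) (h₀ : A₀.toSubring ≤ O.toSubring) (t : K)
    (core : CoreDatum 2 4 k K O A₀ h₀ t) (hrk : ¬ HasProperCoarsening O)
    (R : ℕ → Subring K) (P : (i : ℕ) → Ideal (R i)) (s : ℕ → K)
    (hR0 : R 0 = locAtCentre A₀.toSubring O) (hN : NormalAt O (R 0) 2 t) (hrun : IsSteeredRun O R P t 2 s)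
    (i : ℕ) (hPi : IsPointStep R P i) : IsMaxGenAt (R i) 2 t (s i) := by
  haveI : CharP K 2 := charP_of_injective_algebraMap (algebraMap k K).injective 2
  haveI : Fact (Nat.Prime 2) := ⟨Nat.prime_two⟩
  obtain ⟨-, -, hdim, -, hirr, -⟩ := runHygieneTwo_holds 2 rfl k K O A₀ h₀ t core hrk R P s hR0 hrun
  have hreg : ∀ i, IsRegularLocalRing (R i) := fun i =>
    steeredMembersRegular_holds 2 Nat.prime_two 4 le_rfl k K O A₀ h₀ t core R P s i hR0
      ⟨hrun.1, fun j _ => by obtain ⟨_, hs, -⟩ := hrun.2 j; exact hs, fun j _ => hrun.2 j⟩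
  have hRO : R 0 ≤ O.toSubring := hR0 ▸ locAtCentre_le h₀
  have hloc : locAtCentre (R 0) O = R 0 := by rw [hR0]; exact locAtCentre_locAtCentre A₀.toSubring O
  exact isMaxGenAt_of_pointStep_along_run O R P t s (n := 4) (by norm_num) hreg hdim hRO hloc hirr
    (fun j hs π a b c hπ hπb heq => memberFrobeniusCongruence_two k K O A₀ h₀ t core R P s hR0 hrun j hs π a b c hπ hπb heq)
    hN hrun i hPi

/-- **★ (SH)ᴵ `StrippingTailSwitchingEvenInfShadowConclIndTwoN` (tree `…HevLeafMax`, p552660) HOLDS OUTRIGHT — its (SH) binder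
«∀ i₀, ∃ i ≥ i₀, IsPointStep R P i ∧ ¬ IsMaxGenAt (R i) p t (s i)» contradicts the word's own `NormalAt O (R 0) p t` + `IsSteeredRun` binders.**
No open input; only `CoreDatum`, `¬HasProperCoarsening`, `R 0 = locAtCentre A₀ O`, `NormalAt`, `IsSteeredRun` and the (SH) binder are consumed.
OURS. [folklore] -/
theorem shadowConclInd_holds : StrippingTailSwitchingEvenInfShadowConclIndTwoN := by
  intro p hp2 k K _ _ _ _ _ O A₀ h₀ t core hrk R P s hR0 hN hrun _ _ _ _ _ _ _ _ _ _ hsh _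
  subst hp2
  obtain ⟨i, -, hPi, hnot⟩ := hsh 0
  exact absurd (isMaxGenAt_of_isPointStep k K O A₀ h₀ t core hrk R P s hR0 hN hrun i hPi) hnot

/-- **[hEv-∞]ᴵ `StrippingTailSwitchingEvenInfConclIndTwoN` ⟸ (MAX)ᴵ `StrippingTailSwitchingEvenInfMaxConclIndTwoN` ALONE**
(the landed re-cut `…_of_shadow_of_max` with the (SH) half discharged). OURS. [folklore] -/
theorem evenInfConclInd_of_max (hMax : StrippingTailSwitchingEvenInfMaxConclIndTwoN) :
    StrippingTailSwitchingEvenInfConclIndTwoN :=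
  strippingTailSwitchingEvenInfConclIndTwoN_of_shadow_of_max shadowConclInd_holds hMax

/-- **The (MAX) binder is FREE**: under the [hEv-∞]ᴵ run binders, «eventually every point-step generator is maximal» holds with `i₀ = 0`.
(So (MAX)ᴵ and [hEv-∞]ᴵ are the same statement up to this derivable binder.) OURS. [folklore] -/
theorem maxBinder_of_leafBinders
    (k K : Type) [Field k] [CharP k 2] [PerfectField k] [Field K] [Algebra k K]
    (O : ValuationSubring K) (A₀ : Subalgebra k K) (h₀ : A₀.toSubring ≤ O.toSubring) (t : K)
    (core : CoreDatum 2 4 k K O A₀ h₀ t) (hrk : ¬ HasProperCoarsening O)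
    (R : ℕ → Subring K) (P : (i : ℕ) → Ideal (R i)) (s : ℕ → K)
    (hR0 : R 0 = locAtCentre A₀.toSubring O) (hN : NormalAt O (R 0) 2 t) (hrun : IsSteeredRun O R P t 2 s) :
    ∃ i₀ : ℕ, ∀ i, i₀ ≤ i → IsPointStep R P i → IsMaxGenAt (R i) 2 t (s i) :=
  ⟨0, fun i _ hPi => isMaxGenAt_of_isPointStep k K O A₀ h₀ t core hrk R P s hR0 hN hrun i hPi⟩

end Summit.ResolutionOfSingularities.ResolutionOfSingularities.Theorems.SwitchingDichotomy.MaxVacuity
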